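import Summits.AtomisticToContinuum.Crystallization.Theses.ZeroPressureMagicFunction

/-!
# Birth skeleton (BC3) for crux `MagicFunctionLJ3` — item stmt-AtomisticToContinuum-12146,
# route `ZeroPressureMagicFunction` (rank 2, open-problem class)

Crux (verbatim the route decl, concluded BY NAME below): there is a continuous `g : ℝ³ → ℝ`,
positive-definite in the sense of finite real quadratic forms, with `g x ≤ V_LJ ‖x‖` for `x ≠ 0`,
and a periodic configuration `P` with `e_LJ(P) = -g(0)/2`.

## The line: SPECTRAL-SIDE CERTIFICATE + ZERO-PRESSURE WEAK DUALITY (the Cohn–Elkies / CKMRV cut)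

Every magic function in print (Cohn–Elkies, Viazovska, CKMRV, Cohn–Kumar §9) is specified by TWO
SIGN CONDITIONS — one in physical space (`g ≤ V` off the origin), one in frequency space (`ĝ ≥ 0`) —
and its sharpness is weak duality read backwards.  We cut the crux along exactly these seams, writing
the certificate on the FREQUENCY side as the cosine transform `g_μ(x) = ∫ cos(2π⟪x,ξ⟫) dμ(ξ)` of a
finite positive Borel measure `μ` on `ℝ³` (by Bochner's theorem this parametrises ALL continuous
positive-definite functions, so nothing is lost; `g_μ(0) = μ(ℝ³)`):

* `stub_bochnerCos` (M; TRUE — the easy half of Bochner's theorem, not in Mathlib): the cosine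
  transform of a finite positive measure is positive-definite as a finite real quadratic form:
  `Σᵢⱼ cᵢcⱼ g_μ(xᵢ - xⱼ) = ∫ [(Σᵢ cᵢ cos 2π⟪xᵢ,ξ⟫)² + (Σᵢ cᵢ sin 2π⟪xᵢ,ξ⟫)²] dμ(ξ) ≥ 0`.
* `stub_periodicWeakDuality` (M; TRUE — Fisher–Ruelle / Cohn–Kumar Prop. 9.3 at zero pressure; it is
  DEFINITIONALLY the route's support item `PeriodicBochnerBound3`, stmt-AtomisticToContinuum-12151, so
  one proof closes both): for every positive-definite `g` with `g ≤ V_LJ` off `0` and every periodic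
  `Q`, `-g(0)/2 ≤ e_LJ(Q)` (finite blocks `Q ∩ B_R` + the finite Bochner bound + `r⁻⁶` tails `o(R³)`;
  no Poisson summation, so no regularity of `ĝ` is needed — which is why `μ` may be any finite measure).
* `stub_spectralCandidate` (open-problem; THE load-bearing stub): a finite positive measure `μ` on `ℝ³`
  whose cosine transform is dominated by `V_LJ(‖x‖)` off the origin and whose mass does not exceed
  `-2 e_LJ(P)` for some periodic `P` (expected: relaxed hcp, `e = -L₆²/(24 L₁₂) ≈ -0.7176`; tightness
  then forces `μ({0})·ρ = 0`, `supp μ ∩ Λ_P^* ⊆ {S_P = 0} ∪ {0}`-type extinction and `g_μ = V` on the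
  difference set of `P`).  Only `≤` is asked: the reverse inequality is `stub_periodicWeakDuality`.

`MagicFunctionLJ3_of : MagicFunctionLJ3` is the kernel-checked composition (no `sorry` outside the
three `stub_*`): `g := g_μ` is continuous (PROVED here: dominated convergence, `continuous_cosTransform`),
positive-definite by stub 1, a minorant by stub 3, and `e(P) = -g(0)/2` by `le_antisymm` (stub 3 / stub 2).
The hypothesis form `stub-sigs → MagicFunctionLJ3` is the sorry-free `example` right above it (an
`example`, not a named theorem: `#h21_check_skeleton` takes the first declaration concluding the crux
and admits no inlined `Prop` binders).

Disproof used: none on file (`ledger crux ls` shows no `Disproof.lean` for this crux, 2026-08-17).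
Evidence honoured: the refuter's structural lemma `g 0 ≥ 1/12` (Evidence.lean, 2026-08-15) is
consistent with stub 3 (`μ(ℝ³) = g_μ(0) ≥ 1/12`); the numerical phantom gap (PHANTOM-GAP-j009067,
`-0.7453 < -0.7176`, uncertified) bears on stub 3 ALONE — stubs 1–2 are theorems — so a certified
phantom kills the line exactly at its load-bearing stub, as a birth skeleton should arrange.

Registered signatures are ONE-LINE and fully qualified.
-/

noncomputable section

namespace Summit.AtomisticToContinuum.Crystallization.Cruxes.MagicFunctionLJ3.Birth

open MeasureTheory
open Literature.MathematicalPhysics.StatisticalMechanics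
open Summit.AtomisticToContinuum.Crystallization.Theses.ZeroPressureMagicFunction

/-! ## Proved glue: the cosine transform of a finite measure is continuous -/

/-- Dominated convergence: `x ↦ ∫ cos(2π⟪x,ξ⟫) dμ(ξ)` is continuous for a finite measure `μ`
(integrand bounded by `1`, continuous in `x`). -/
theorem continuous_cosTransform (μ : MeasureTheory.Measure (EuclideanSpace ℝ (Fin 3)))
    [MeasureTheory.IsFiniteMeasure μ] :
    Continuous (fun x : EuclideanSpace ℝ (Fin 3) => ∫ ξ, Real.cos (2 * Real.pi * inner ℝ x ξ) ∂μ) := by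
  refine MeasureTheory.continuous_of_dominated (bound := fun _ => (1 : ℝ)) ?_ ?_ ?_ ?_
  · intro x
    exact (Real.continuous_cos.comp (continuous_const.mul (continuous_const.inner continuous_id))).aestronglyMeasurable
  · intro x
    exact Filter.Eventually.of_forall fun ξ => by
      simpa using Real.abs_cos_le_one (2 * Real.pi * inner ℝ x ξ)
  · exact MeasureTheory.integrable_const 1
  · exact Filter.Eventually.of_forall fun ξ =>
      Real.continuous_cos.comp (continuous_const.mul (continuous_id.inner continuous_const))

/-! ## Registered stubs (the ONLY `sorry`s of the file; one-line, fully qualified signatures) -/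

/-- **STUB 1 — easy Bochner for cosine transforms** (M; true).  For every finite positive Borel
measure `μ` on `ℝ³`, the cosine transform `g_μ(x) = ∫ cos(2π⟪x,ξ⟫) dμ(ξ)` is positive-definite as
a finite real quadratic form.  Proof in print: expand `cos(a - b) = cos a cos b + sin a sin b`, swap
the finite sums with the integral, and integrate the sum of two squares.  Why it might fail: it
cannot as a statement; the cost is the finite-sum/integral bookkeeping (`integral_finset_sum`,
`Finset.sum_mul_sum`) — not in Mathlib as stated (Mathlib has no positive-definite-function API). -/
theorem stub_bochnerCos : ∀ (μ : MeasureTheory.Measure (EuclideanSpace ℝ (Fin 3))), MeasureTheory.IsFiniteMeasure μ → ∀ (n : ℕ) (x : Fin n → EuclideanSpace ℝ (Fin 3)) (c : Fin n → ℝ), 0 ≤ ∑ i, ∑ j, c i * c j * ∫ ξ, Real.cos (2 * Real.pi * inner ℝ (x i - x j) ξ) ∂μ := by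
  sorry

/-- **STUB 2 — zero-pressure weak duality for periodic configurations** (M; true: Fisher–Ruelle /
Cohn–Kumar Prop. 9.3 with no density term).  For every `g : ℝ³ → ℝ` that is positive-definite as a
finite real quadratic form and satisfies `g x ≤ V_LJ ‖x‖` for `x ≠ 0`, every periodic configuration
`Q` has `-g(0)/2 ≤ e_LJ(Q)`.  DEFINITIONALLY EQUAL to the route support item
`ZeroPressureMagicFunction.PeriodicBochnerBound3` (stmt-AtomisticToContinuum-12151; see the `example`
below), so its prover closes this stub verbatim.  Route of proof: the finite bound
`Σ_{i<j} V ≥ -N g(0)/2` on the blocks `Q ∩ B_R` (c ≡ 1 in the quadratic form, symmetrisation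
`g(x)+g(-x) ≤ 2V`), boundary pairs `O(R² L⁴)` and `r⁻⁶` tails `O(R³ L⁻³)` with `L = R^{1/5}`, divide by
`#(Q ∩ B_R) ~ ρ|B_R|`.  Why it might fail: only through the `tsum` junk value in `energyPerParticle`
— excluded in `d = 3` for Lennard-Jones (uniformly discrete point set, `r⁻⁶` summable:
`PeriodicConfiguration.summable_lennardJones_dist_three` pattern). -/
theorem stub_periodicWeakDuality : ∀ (g : EuclideanSpace ℝ (Fin 3) → ℝ), (∀ (n : ℕ) (x : Fin n → EuclideanSpace ℝ (Fin 3)) (c : Fin n → ℝ), 0 ≤ ∑ i, ∑ j, c i * c j * g (x i - x j)) → (∀ x : EuclideanSpace ℝ (Fin 3), x ≠ 0 → g x ≤ Literature.MathematicalPhysics.StatisticalMechanics.lennardJones ‖x‖) → ∀ Q : Literature.MathematicalPhysics.StatisticalMechanics.PeriodicConfiguration 3, -(g 0) / 2 ≤ Q.energyPerParticle Literature.MathematicalPhysics.StatisticalMechanics.lennardJones := by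
  sorry

/-- **STUB 3 — the spectral-side certificate** (open-problem; load-bearing).  There is a finite
positive Borel measure `μ` on `ℝ³` whose cosine transform `g_μ` satisfies `g_μ(x) ≤ V_LJ(‖x‖)` for
`x ≠ 0` (physical-space sign condition; the frequency-side one, `ĝ = μ ≥ 0`, is built into the
parametrisation) and a periodic configuration `P` with `e_LJ(P) ≤ -g_μ(0)/2 = -μ(ℝ³)/2` (the bound
REACHES a periodic energy; equality is then forced by stub 2).  Expected `P` = relaxed hcp,
`-g_μ(0)/2 = -L₆²/(24 L₁₂) ≈ -0.7176`, `μ` absolutely continuous away from an atom-free origin with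
density vanishing on the reciprocal set of `P` where the structure factor is non-zero.  Why it might
fail: two-point bounds are not sharp in `d = 3` for packing (Li 2022: 0.18398 > 0.17678) or kissing
(13.16 > 12), and the uncertified phantom LP of item 11959 (kit j009067) reports a dual value
`-0.7453 < e(hcp)`; one certified phantom pair measure refutes this stub (and the crux). -/
theorem stub_spectralCandidate : ∃ μ : MeasureTheory.Measure (EuclideanSpace ℝ (Fin 3)), MeasureTheory.IsFiniteMeasure μ ∧ (∀ x : EuclideanSpace ℝ (Fin 3), x ≠ 0 → ∫ ξ, Real.cos (2 * Real.pi * inner ℝ x ξ) ∂μ ≤ Literature.MathematicalPhysics.StatisticalMechanics.lennardJones ‖x‖) ∧ ∃ P : Literature.MathematicalPhysics.StatisticalMechanics.PeriodicConfiguration 3, P.energyPerParticle Literature.MathematicalPhysics.StatisticalMechanics.lennardJones ≤ -(∫ ξ, Real.cos (2 * Real.pi * inner ℝ (0 : EuclideanSpace ℝ (Fin 3)) ξ) ∂μ) / 2 := by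
  sorry

/-! ## Sanity: stub 2 IS the route support item `PeriodicBochnerBound3` (definitional) -/

example : Summit.AtomisticToContinuum.Crystallization.Theses.ZeroPressureMagicFunction.PeriodicBochnerBound3 ↔ (∀ (g : EuclideanSpace ℝ (Fin 3) → ℝ), (∀ (n : ℕ) (x : Fin n → EuclideanSpace ℝ (Fin 3)) (c : Fin n → ℝ), 0 ≤ ∑ i, ∑ j, c i * c j * g (x i - x j)) → (∀ x : EuclideanSpace ℝ (Fin 3), x ≠ 0 → g x ≤ Literature.MathematicalPhysics.StatisticalMechanics.lennardJones ‖x‖) → ∀ Q : Literature.MathematicalPhysics.StatisticalMechanics.PeriodicConfiguration 3, -(g 0) / 2 ≤ Q.energyPerParticle Literature.MathematicalPhysics.StatisticalMechanics.lennardJones) :=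
  Iff.rfl

/-! ## Composition (kernel-checked): the stubs imply the crux BY NAME -/

/-- The positive-definiteness of `g_μ` in the crux's own (finite quadratic form) phrasing, from
stub 1's statement taken as a hypothesis. -/
theorem posDef_cosTransform_of
    (hB : ∀ (μ : MeasureTheory.Measure (EuclideanSpace ℝ (Fin 3))), MeasureTheory.IsFiniteMeasure μ → ∀ (n : ℕ) (x : Fin n → EuclideanSpace ℝ (Fin 3)) (c : Fin n → ℝ), 0 ≤ ∑ i, ∑ j, c i * c j * ∫ ξ, Real.cos (2 * Real.pi * inner ℝ (x i - x j) ξ) ∂μ)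
    (μ : MeasureTheory.Measure (EuclideanSpace ℝ (Fin 3))) (hμ : MeasureTheory.IsFiniteMeasure μ) :
    ∀ (n : ℕ) (x : Fin n → EuclideanSpace ℝ (Fin 3)) (c : Fin n → ℝ),
      0 ≤ ∑ i, ∑ j, c i * c j * (fun y : EuclideanSpace ℝ (Fin 3) => ∫ ξ, Real.cos (2 * Real.pi * inner ℝ y ξ) ∂μ) (x i - x j) :=
  fun n x c => hB μ hμ n x c

/-- HYPOTHESIS FORM (BC3 letter; sorry-free): the three stub STATEMENTS imply the crux.  Kept as an
`example` so that `MagicFunctionLJ3_of` below is the file's first declaration concluding the crux by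
name (the registered form `#h21_check_skeleton` analyses). -/
example : (∀ (μ : MeasureTheory.Measure (EuclideanSpace ℝ (Fin 3))), MeasureTheory.IsFiniteMeasure μ → ∀ (n : ℕ) (x : Fin n → EuclideanSpace ℝ (Fin 3)) (c : Fin n → ℝ), 0 ≤ ∑ i, ∑ j, c i * c j * ∫ ξ, Real.cos (2 * Real.pi * inner ℝ (x i - x j) ξ) ∂μ) → (∀ (g : EuclideanSpace ℝ (Fin 3) → ℝ), (∀ (n : ℕ) (x : Fin n → EuclideanSpace ℝ (Fin 3)) (c : Fin n → ℝ), 0 ≤ ∑ i, ∑ j, c i * c j * g (x i - x j)) → (∀ x : EuclideanSpace ℝ (Fin 3), x ≠ 0 → g x ≤ Literature.MathematicalPhysics.StatisticalMechanics.lennardJones ‖x‖) → ∀ Q : Literature.MathematicalPhysics.StatisticalMechanics.PeriodicConfiguration 3, -(g 0) / 2 ≤ Q.energyPerParticle Literature.MathematicalPhysics.StatisticalMechanics.lennardJones) → (∃ μ : MeasureTheory.Measure (EuclideanSpace ℝ (Fin 3)), MeasureTheory.IsFiniteMeasure μ ∧ (∀ x : EuclideanSpace ℝ (Fin 3), x ≠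 0 → ∫ ξ, Real.cos (2 * Real.pi * inner ℝ x ξ) ∂μ ≤ Literature.MathematicalPhysics.StatisticalMechanics.lennardJones ‖x‖) ∧ ∃ P : Literature.MathematicalPhysics.StatisticalMechanics.PeriodicConfiguration 3, P.energyPerParticle Literature.MathematicalPhysics.StatisticalMechanics.lennardJones ≤ -(∫ ξ, Real.cos (2 * Real.pi * inner ℝ (0 : EuclideanSpace ℝ (Fin 3)) ξ) ∂μ) / 2) → Summit.AtomisticToContinuum.Crystallization.Theses.ZeroPressureMagicFunction.MagicFunctionLJ3 := by
  intro hB hW hC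
  obtain ⟨μ, hμ, hmin, P, hP⟩ := hC
  haveI := hμ
  refine ⟨fun y => ∫ ξ, Real.cos (2 * Real.pi * inner ℝ y ξ) ∂μ, continuous_cosTransform μ,
    posDef_cosTransform_of hB μ hμ, hmin, P, ?_⟩
  exact le_antisymm hP (hW _ (posDef_cosTransform_of hB μ hμ) hmin P)

/-- THE SKELETON THEOREM (registered form: concludes the route decl `MagicFunctionLJ3` BY NAME, no
hypotheses, `sorry` only through the three declared `stub_*`). -/
theorem MagicFunctionLJ3_of : Summit.AtomisticToContinuum.Crystallization.Theses.ZeroPressureMagicFunction.MagicFunctionLJ3 := by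
  obtain ⟨μ, hμ, hmin, P, hP⟩ := stub_spectralCandidate
  haveI := hμ
  refine ⟨fun y => ∫ ξ, Real.cos (2 * Real.pi * inner ℝ y ξ) ∂μ, continuous_cosTransform μ,
    posDef_cosTransform_of stub_bochnerCos μ hμ, hmin, P, ?_⟩
  exact le_antisymm hP (stub_periodicWeakDuality _ (posDef_cosTransform_of stub_bochnerCos μ hμ) hmin P)

end Summit.AtomisticToContinuum.Crystallization.Cruxes.MagicFunctionLJ3.Birth

end
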